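import Literature.MathematicalPhysics.QuantumFieldTheory.Balaban1983to89.B14Eq216Concrete

/-!
# Bałaban [III] (CMP 119) (1.2) p. 246 / (2.12) p. 256 / (2.16) p. 257: the interior locality of the minimal
configurations `U(𝐁, ·)` is a NORMALISATION of the carrier — the p. 246 sentence at support level, unconditionally

statement-level skeleton of published theorems with citation tags; proofs where landed; nothing here is a claim about the Yang–Mills mass gap

[Balaban1988Convergent] T. Bałaban, *Convergent renormalization expansions for lattice gauge theories*,
Commun. Math. Phys. **119** (1988) 243–285; (1.2) p. 246 [PDF 4], (2.10)–(2.13) p. 256 [PDF 14], (2.16) p. 257 [PDF 15].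

WHAT THIS FILE SETTLES.  Row B14.Eq1.2 of the B14 skeleton types (1.2) `U_{1,□′}(V) = U(𝐁₁(□′^{∼4}), M˙(Q₁^{s*}V))`
WITH BODY on the carriers of record (`B14Eq216Concrete.sect1Of`, `ukBox`; r12's solution-map carrier
`B15DeterminingSets.DetBackground` of the variational problem (2.12)).  The one printed sentence of the row that print
USES, p. 246 *"The function in (1.2) depends on the field V restricted to □′^{∼4}"*, was a kernel theorem only in
CONDITIONAL form: `B14Eq216Concrete.u1loc_congr_on` / `ukBox_congr_on` carry the hypothesis `hloc` — the INTERIOR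
LOCALITY of the minimizer: *data that agree NEAR the support of `𝐁` give the same configuration ON the support* (READING
NOTE of `B14Eq216Concrete`: by (2.2) the scale-0 member of a determining set on the torus is `Γ₀ = Ω₁ᶜ`, so the
whole-torus configuration `U(𝐁, X)` carries the datum `X₀` on all of `Ω₁ᶜ`; print's sentence concerns the configuration
where (1.4) reads it, on the support, p. 255 *"The domain Ω₁, or rather a small neighborhood of Ω₁ …, is called its
support"*).  HERE that hypothesis is DISCHARGED as a normalisation, in the manner of r13's
`B16Eq150VariableFields.exists_local` for the (2.10)-locality (lead g14, HEAD WORD Q-B16-102-1, HOME/STATUS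
2026-08-23T20:51:10Z: a locality clause cutting the carrier back to print's generality is READING, zero weight, when the
normalisation is certified free):

**THEOREM (`normalise`, `isMinimizer_spliceCfg`, `normalise_local`).**  Let `bg` be ANY solution map of the (2.12)
spec whose regular class is plaquette-determined (`PlaqDetermined`; print p. 256 *"regular … in the sense that
|∂V_{j−1} − 1| < O(L²)ε_{j−1}"*, (2.12) *"U : U regular"* — identified with the tree's `Setup.PlaqSmall` /
`PlaqSmallOn` classes by `plaqDetermined_plaqSmall` / `plaqDetermined_plaqSmallOn`).  Then `normalise bg` is again a
solution map of the SAME spec with the SAME regular class and the SAME domain of admissible data (a `DetBackground`: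
for every determining set `𝔹` and every admissible datum `X`, `(normalise bg).U 𝔹 X` IS a minimal configuration of
(2.12) for `𝔹, X` — `isMinimizer_normalise`), and at every `𝔹` of the standing range
* on the `Γ₀`-bonds it IS the datum, `(normalise bg).U 𝔹 X = X₀` (`normalise_U_ext`; the (2.12) constraint at scale
  `0`, `M⁰ = id`); inside it is `bg`'s own minimal configuration for the canonical admissible datum `rep bg 𝔹 X`
  agreeing with `X` near the support (`normalise_U_int`; Hilbert's `ε` on the near-equivalence class, `rep_spec`,
  `rep_eq_of_agreeOn`);
* INTERIOR LOCALITY, PROVED: if `X`, `X′` agree on `near 𝔹` — the layers `Γ_j`, `j ≥ 1`, and those `Γ₀`-sites that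
  are a vertex of a plaquette meeting the interior or an endpoint of a bond feeding a higher layer — then
  `(normalise bg).U 𝔹 X = (normalise bg).U 𝔹 X′` on every bond except the far `Γ₀`-bonds (`normalise_local`): exactly
  the `hloc` shape of `ukBox_congr_on` with `𝔅′ := near 𝔹`, `S := (farBonds 𝔹)ᶜ`; a fortiori the (2.10)-agreement
  shape of `ukBox_congr` (`normalise_local_of_agreeOn`).
MECHANISM (no [15] input): with `X̃ = rep bg 𝔹 X` and `Ũ` its minimizer, the splice `(X₀ ∣ Ũ)` — datum on the
`Γ₀`-bonds, `Ũ` inside — is compared with a competitor `U` through the transported competitor `(X̃₀ ∣ U)` for `X̃`: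
plaquette by plaquette the four configurations pair off (`splice_splice_plaq`), whence
`A(X₀ ∣ Ũ) + A(X̃₀ ∣ U) = A(U) + A(Ũ)` for the Wilson action `Setup.wilsonAction4` (`action_splice_add`), and
`A(Ũ) ≤ A(X̃₀ ∣ U)` gives `A(X₀ ∣ Ũ) ≤ A(U)`; regularity of the splices is read off plaquette-wise; the constraints use
the locality of `M^j` (2.11) (`B14Eq216Concrete.iter_local`).

CONSEQUENCES (the p. 246 sentence, NO `hloc`).  §4: **(2.16)** `ukBox_normalise_congr_on` — `U_{k,□}(V_k)` built on
`normalise bg` agrees on the support bonds `(farBonds 𝐁_k(□^{∼4}))ᶜ` for `V_k = W_k` on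
`liftIter k (inputs (near 𝐁_k(□^{∼4})))`; **(1.2)** `u1loc_normalise_congr_on` — the same for `U_{1,□′}(V)` of
`sect1Of (normalise bg)`.  The agreement set is contained in the whole-torus one (`inputs_near_subset`) and omits exactly
the far exterior: in print's geometry (p. 256 *"dist(Ω_n, Ω^c_{n−1}) ≥ L^nξM₁"*, the cubes `□′^{∼4} ⊃ Ω₁(□′^{∼4})`
being PARAMETERS `enl4`, `maxDomT` here) these bonds lie over `□′^{∼4}` — print's *"restricted to □′^{∼4}"*.

NOT ASSERTED: existence or uniqueness of minimal configurations ([15] = [Balaban1985Variational] Thm 1, row B14.Eq2.12),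
the cube geometry of pp. 245/256–257, anything about (2.18).  No `Prop` definitions without body (`PlaqDetermined`,
like every definition here, has a body and print's instances are PROVED to satisfy it), no `sorry`.

Mega-formalization `lit-balaban`, unit `lit-balaban-r11` (CMP 119, B14 fold owner), SKELETON row **B14.Eq1.2** (member p373726,
r11 gen 100).  v1.1 (r11 gen 101): DOC-ONLY — the cell's framing line added on page 1 (referee ref-3 note N-g98-1 relayed by
the lead 2026-08-24T14:30Z); no declaration touched.

## References
* [Balaban1988Convergent] T. Bałaban, Commun. Math. Phys. 119 (1988) 243–285, (1.2) p. 246, (2.2) p. 255,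
  (2.10)–(2.13) p. 256, (2.16) p. 257.
* [Balaban1985Variational] T. Bałaban, Commun. Math. Phys. 102 (1985) 277–309, Thm 1 ([15]).
* [Balaban1989LargeFieldII] T. Bałaban, Commun. Math. Phys. 122 (1989) 355–392, (1.50) p. 370 (r13's `exists_local`,
  the model of this normalisation; its bookkeeping lemmas `bondsOf_mono`, `agreeOn_symm/trans` are NOT restated here —
  the two uses are inlined one-liners).
-/

noncomputable section

namespace Literature.MathematicalPhysics.QuantumFieldTheory.Balaban1983to89.B14.Eq12InteriorLocality

open Literature.MathematicalPhysics.QuantumFieldTheory.Balaban1983to89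
open B15DeterminingSets B14.Eq213DetSet B14.Eq216Concrete
open Literature.MathematicalPhysics.QuantumFieldTheory.BalabanImbrieJaffe1984to88.BIJ85Eq453GaugeField
open scoped BigOperators

/-! ## §0  Plaquette bookkeeping: the four bonds of `∂p`, plaquette-determined classes -/

section Plaquettes

variable {P : Params} {j : ℕ}

/-- The four (positively oriented) bonds of the plaquette boundary `∂p = ⟨x, x+e_μ, x+e_μ+e_ν, x+e_ν⟩` entering
`U(∂p)` (`Setup.GaugeField.plaqHol`). [cite: Balaban1985Averaging, (9) p.19] -/
def plaqBonds (p : Plaq P j) : Set (PBond P j) :=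
  {⟨p.src, p.μ⟩, ⟨p.src.shift p.μ, p.ν⟩, ⟨p.src.shift p.ν, p.μ⟩, ⟨p.src, p.ν⟩}

/-- Membership in `plaqBonds p`. [cite: Balaban1985Averaging, (9) p.19] -/
theorem mem_plaqBonds {p : Plaq P j} {b : PBond P j} :
    b ∈ plaqBonds p ↔ b = ⟨p.src, p.μ⟩ ∨ b = ⟨p.src.shift p.μ, p.ν⟩ ∨ b = ⟨p.src.shift p.ν, p.μ⟩ ∨ b = ⟨p.src, p.ν⟩ := by
  simp only [plaqBonds, Set.mem_insert_iff, Set.mem_singleton_iff]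

variable {G : Type*} [GaugeGroup G]

/-- **Locality of the plaquette variable**: `U(∂p)` depends on `U` only through the four bonds of `∂p`. [cite: Balaban1985Averaging, (9) p.19] -/
theorem plaqHol_congr {U U' : GaugeField P j G} {p : Plaq P j} (h : ∀ b ∈ plaqBonds p, U b = U' b) :
    GaugeField.plaqHol U p = GaugeField.plaqHol U' p := by
  unfold GaugeField.plaqHol
  rw [h ⟨p.src, p.μ⟩ (mem_plaqBonds.2 (Or.inl rfl)), h ⟨p.src.shift p.μ, p.ν⟩ (mem_plaqBonds.2 (Or.inr (Or.inl rfl))),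
    h ⟨p.src.shift p.ν, p.μ⟩ (mem_plaqBonds.2 (Or.inr (Or.inr (Or.inl rfl)))),
    h ⟨p.src, p.ν⟩ (mem_plaqBonds.2 (Or.inr (Or.inr (Or.inr rfl))))]

/-- A class of configurations is PLAQUETTE-DETERMINED when membership is a condition on the plaquette variables `U(∂p)`,
one plaquette at a time — the form of print's regularity, p. 256: *"regular … in the sense that |∂V_{j−1} − 1| <
O(L²)ε_{j−1}"*, (2.12) *"U : U regular"*. [cite: Balaban1988Convergent, (2.12) p.256] -/
def PlaqDetermined (reg : Set (GaugeField P j G)) : Prop :=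
  ∃ good : Plaq P j → Set G, ∀ U, U ∈ reg ↔ ∀ p, GaugeField.plaqHol U p ∈ good p

/-- Any class given plaquette-wise is plaquette-determined. [cite: Balaban1988Convergent, (2.12) p.256] -/
theorem plaqDetermined_setOf (good : Plaq P j → Set G) :
    PlaqDetermined {U : GaugeField P j G | ∀ p, GaugeField.plaqHol U p ∈ good p} :=
  ⟨good, fun _ => Iff.rfl⟩

/-- The unrestricted class is plaquette-determined. [cite: Balaban1988Convergent, (2.12) p.256] -/
theorem plaqDetermined_univ : PlaqDetermined (Set.univ : Set (GaugeField P j G)) :=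
  ⟨fun _ => Set.univ, fun U => ⟨fun _ _ => Set.mem_univ _, fun _ => Set.mem_univ U⟩⟩

/-- Print's instance: the regular class `{U : |U(∂p) − 1| < δ for all p}` (`Setup.PlaqSmall`) is plaquette-determined.
[cite: Balaban1988Convergent, (2.12) p.256] -/
theorem plaqDetermined_plaqSmall (δ : ℝ) : PlaqDetermined {U : GaugeField P j G | PlaqSmall δ U} :=
  ⟨fun _ => {g | GaugeGroup.dist1 g < δ}, fun _ => Iff.rfl⟩

open Classical in
/-- Print's instance with a region: `{U : |U(∂p) − 1| < δ for p ∈ S}` (`Setup.PlaqSmallOn`) is plaquette-determined.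
[cite: Balaban1988Convergent, (2.12) p.256] -/
theorem plaqDetermined_plaqSmallOn (S : Set (Plaq P j)) (δ : ℝ) :
    PlaqDetermined {U : GaugeField P j G | PlaqSmallOn S δ U} := by
  refine ⟨fun p => if p ∈ S then {g | GaugeGroup.dist1 g < δ} else Set.univ, fun U => ?_⟩
  constructor
  · intro h p
    show GaugeField.plaqHol U p ∈ (if p ∈ S then {g | GaugeGroup.dist1 g < δ} else Set.univ)
    by_cases hp : p ∈ S
    · rw [if_pos hp]
      exact h p hp
    · rw [if_neg hp]
      exact Set.mem_univ _
  · intro h p hp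
    have h' : GaugeField.plaqHol U p ∈ (if p ∈ S then {g | GaugeGroup.dist1 g < δ} else Set.univ) := h p
    rw [if_pos hp] at h'
    exact h'

end Plaquettes

/-! ## §1  The support bookkeeping of a determining set: `Γ₀`-bonds, near sites, far bonds, splicing -/

section Support

variable {P : Params}

/-- The `Γ₀`-BONDS of a determining set `𝔹 = {Γ_j}`: the bonds of `T_η` meeting `Γ₀` — where the (2.12) constraint
at scale `0` (`M⁰ = id` in (2.11)) FIXES a constrained configuration to the datum; by (2.2) `Γ₀ = Ω₁ᶜ`.
[cite: Balaban1988Convergent, (2.2) p.255, (2.11) p.256] -/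
abbrev extBonds (𝔹 : DetSet P) : Set (PBond P 0) := bondsOf (𝔹 0)

/-- The fine bonds FEEDING the data on the higher layers `Γ_j`, `j ≥ 1`, through the averages `M^j` of (2.11)
(`B14Eq216Concrete.feeds`). [cite: Balaban1988Convergent, (2.11) p.256] -/
def inputsPos (𝔹 : DetSet P) : Set (PBond P 0) :=
  ⋃ (j : ℕ) (b : PBond P (j + 1)) (_ : b ∈ bondsOf (𝔹 (j + 1))), feeds (j + 1) b

/-- Membership in `inputsPos 𝔹`. [cite: Balaban1988Convergent, (2.11) p.256] -/
theorem mem_inputsPos {𝔹 : DetSet P} {b₀ : PBond P 0} :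
    b₀ ∈ inputsPos 𝔹 ↔ ∃ (j : ℕ) (b : PBond P (j + 1)), b ∈ bondsOf (𝔹 (j + 1)) ∧ b₀ ∈ feeds (j + 1) b := by
  simp only [inputsPos, Set.mem_iUnion, exists_prop]

/-- The NEAR `Γ₀`-sites: the sites of `Γ₀` that are an endpoint of a bond of a plaquette not entirely made of
`Γ₀`-bonds (the plaquettes through which the interior interacts with the datum), or an endpoint of a bond feeding a
higher layer — p. 255's *"small neighborhood of Ω₁"* belonging to the support. [cite: Balaban1988Convergent, (2.2) p.255] -/
def nearSites (𝔹 : DetSet P) : Set (Site P 0) :=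
  {y | y ∈ 𝔹 0 ∧ ∃ b : PBond P 0, (y = b.src ∨ y = b.tgt) ∧
    ((∃ p : Plaq P 0, b ∈ plaqBonds p ∧ ¬ plaqBonds p ⊆ extBonds 𝔹) ∨ b ∈ inputsPos 𝔹)}

/-- The near sites lie in `Γ₀`. [cite: Balaban1988Convergent, (2.2) p.255] -/
theorem nearSites_subset (𝔹 : DetSet P) : nearSites 𝔹 ⊆ 𝔹 0 := fun _ h => h.1

/-- The NEAR determining set: `Γ₀` cut back to its near sites, the layers `Γ_j`, `j ≥ 1`, unchanged.
[cite: Balaban1988Convergent, (2.2) p.255, (2.10) p.256] -/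
def near (𝔹 : DetSet P) : (j : ℕ) → Set (Site P j)
  | 0 => nearSites 𝔹
  | j + 1 => 𝔹 (j + 1)

/-- `near 𝔹` at scale `0`. [cite: Balaban1988Convergent, (2.2) p.255] -/
@[simp] theorem near_zero (𝔹 : DetSet P) : near 𝔹 0 = nearSites 𝔹 := rfl

/-- `near 𝔹` at the scales `j ≥ 1`. [cite: Balaban1988Convergent, (2.2) p.255] -/
@[simp] theorem near_succ (𝔹 : DetSet P) (j : ℕ) : near 𝔹 (j + 1) = 𝔹 (j + 1) := rfl

/-- `near 𝔹 ⊆ 𝔹` scale by scale. [cite: Balaban1988Convergent, (2.2) p.255] -/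
theorem near_subset (𝔹 : DetSet P) : ∀ j, near 𝔹 j ⊆ 𝔹 j
  | 0 => nearSites_subset 𝔹
  | _ + 1 => subset_rfl

/-- `near 𝔹` lives in the standing range when `𝔹` does. [cite: Balaban1988Convergent, (2.2) p.255] -/
theorem near_range {𝔹 : DetSet P} (h𝔹 : ∀ j, P.m + P.K < j → 𝔹 j = ∅) : ∀ j, P.m + P.K < j → near 𝔹 j = ∅
  | 0, h => absurd h (Nat.not_lt_zero _)
  | j + 1, h => h𝔹 (j + 1) h

/-- The fine inputs of the near data are among the whole-torus inputs (`B14Eq216Concrete.inputs`).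
[cite: Balaban1988Convergent, (2.11) p.256] -/
theorem inputs_near_subset (𝔹 : DetSet P) : inputs (near 𝔹) ⊆ inputs 𝔹 := by
  intro b₀ hb₀
  obtain ⟨j, b, hb, hb₀⟩ := mem_inputs.1 hb₀
  exact mem_inputs.2 ⟨j, b, hb.elim (fun h => Or.inl (near_subset 𝔹 j h)) (fun h => Or.inr (near_subset 𝔹 j h)), hb₀⟩

/-- The FAR `Γ₀`-bonds: the `Γ₀`-bonds meeting no near site. [cite: Balaban1988Convergent, (2.2) p.255] -/
def farBonds (𝔹 : DetSet P) : Set (PBond P 0) := extBonds 𝔹 \ bondsOf (nearSites 𝔹)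

/-- Far bonds are `Γ₀`-bonds. [cite: Balaban1988Convergent, (2.2) p.255] -/
theorem farBonds_subset_extBonds (𝔹 : DetSet P) : farBonds 𝔹 ⊆ extBonds 𝔹 := fun _ h => h.1

/-- A `Γ₀`-bond that is not far meets a near site. [cite: Balaban1988Convergent, (2.2) p.255] -/
theorem near_of_ext_not_far {𝔹 : DetSet P} {b : PBond P 0} (hbE : b ∈ extBonds 𝔹) (hfar : b ∉ farBonds 𝔹) :
    b ∈ bondsOf (nearSites 𝔹) := by
  by_contra h
  exact hfar ⟨hbE, h⟩

/-- CLAIM A: a `Γ₀`-bond of a plaquette that is not entirely made of `Γ₀`-bonds meets a near site.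
[cite: Balaban1988Convergent, (2.2) p.255] -/
theorem mem_bondsOf_nearSites_of_plaq {𝔹 : DetSet P} {p : Plaq P 0} (hp : ¬ plaqBonds p ⊆ extBonds 𝔹) {b : PBond P 0}
    (hb : b ∈ plaqBonds p) (hbE : b ∈ extBonds 𝔹) : b ∈ bondsOf (nearSites 𝔹) := by
  rcases hbE with h | h
  · exact Or.inl ⟨h, b, Or.inl rfl, Or.inl ⟨p, hb, hp⟩⟩
  · exact Or.inr ⟨h, b, Or.inr rfl, Or.inl ⟨p, hb, hp⟩⟩

/-- CLAIM B: a `Γ₀`-bond feeding a higher layer meets a near site. [cite: Balaban1988Convergent, (2.11) p.256] -/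
theorem mem_bondsOf_nearSites_of_inputsPos {𝔹 : DetSet P} {b : PBond P 0} (hb : b ∈ inputsPos 𝔹) (hbE : b ∈ extBonds 𝔹) :
    b ∈ bondsOf (nearSites 𝔹) := by
  rcases hbE with h | h
  · exact Or.inl ⟨h, b, Or.inl rfl, Or.inr hb⟩
  · exact Or.inr ⟨h, b, Or.inr rfl, Or.inr hb⟩

/-- The bonds of a plaquette meeting the interior are not far. [cite: Balaban1988Convergent, (2.2) p.255] -/
theorem not_mem_farBonds_of_plaq {𝔹 : DetSet P} {p : Plaq P 0} (hp : ¬ plaqBonds p ⊆ extBonds 𝔹) {b : PBond P 0}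
    (hb : b ∈ plaqBonds p) : b ∉ farBonds 𝔹 :=
  fun h => h.2 (mem_bondsOf_nearSites_of_plaq hp hb h.1)

/-- The bonds feeding a higher layer are not far. [cite: Balaban1988Convergent, (2.11) p.256] -/
theorem not_mem_farBonds_of_inputsPos {𝔹 : DetSet P} {b : PBond P 0} (hb : b ∈ inputsPos 𝔹) : b ∉ farBonds 𝔹 :=
  fun h => h.2 (mem_bondsOf_nearSites_of_inputsPos hb h.1)

variable {G : Type*}

/-- Agreement on `𝔹` implies agreement on `near 𝔹`. [cite: Balaban1988Convergent, (2.10) p.256] -/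
theorem agreeOn_near_of_agreeOn {𝔹 : DetSet P} {V W : MSField P G} (h : AgreeOn 𝔹 V W) : AgreeOn (near 𝔹) V W :=
  fun j b hb => h j b (hb.elim (fun h1 => Or.inl (near_subset 𝔹 j h1)) (fun h2 => Or.inr (near_subset 𝔹 j h2)))

open Classical in
/-- SPLICE: the datum on the `Γ₀`-bonds, a given configuration inside. [cite: Balaban1988Convergent, (2.12) p.256] -/
def spliceCfg (𝔹 : DetSet P) (X : MSField P G) (Uin : GaugeField P 0 G) : GaugeField P 0 G :=
  fun b => if b ∈ extBonds 𝔹 then X 0 b else Uin b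

open Classical in
/-- The splice on a `Γ₀`-bond. [cite: Balaban1988Convergent, (2.12) p.256] -/
theorem spliceCfg_of_ext {𝔹 : DetSet P} (X : MSField P G) (Uin : GaugeField P 0 G) {b : PBond P 0} (hb : b ∈ extBonds 𝔹) :
    spliceCfg 𝔹 X Uin b = X 0 b := by
  show (if b ∈ extBonds 𝔹 then X 0 b else Uin b) = X 0 b
  rw [if_pos hb]

open Classical in
/-- The splice off the `Γ₀`-bonds. [cite: Balaban1988Convergent, (2.12) p.256] -/
theorem spliceCfg_of_not_ext {𝔹 : DetSet P} (X : MSField P G) (Uin : GaugeField P 0 G) {b : PBond P 0}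
    (hb : b ∉ extBonds 𝔹) : spliceCfg 𝔹 X Uin b = Uin b := by
  show (if b ∈ extBonds 𝔹 then X 0 b else Uin b) = Uin b
  rw [if_neg hb]

end Support

/-! ## §2  The splice is a minimal configuration: plaquette pairing, the action identity, minimality -/

section Core

variable {P : Params} {G : Type*} [GaugeGroup G]

/-- PLAQUETTE PAIRING.  Let `X`, `X̃` agree on `near 𝔹`, `Ũ = X̃₀` and `U = X₀` on the `Γ₀`-bonds.  On every plaquette
EITHER the splice `(X₀ ∣ Ũ)` has the plaquette variable of `U` and the splice `(X̃₀ ∣ U)` that of `Ũ` (plaquettes made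
of `Γ₀`-bonds), OR the other way round (plaquettes meeting the interior, whose `Γ₀`-bonds are near).
[cite: Balaban1988Convergent, (2.12) p.256] -/
theorem splice_splice_plaq (𝔹 : DetSet P) {X Xt : MSField P G} (hXt : AgreeOn (near 𝔹) X Xt) {Ut U : GaugeField P 0 G}
    (hUt : ∀ b ∈ extBonds 𝔹, Ut b = Xt 0 b) (hU : ∀ b ∈ extBonds 𝔹, U b = X 0 b) (p : Plaq P 0) :
    (GaugeField.plaqHol (spliceCfg 𝔹 X Ut) p = GaugeField.plaqHol U p ∧
        GaugeField.plaqHol (spliceCfg 𝔹 Xt U) p = GaugeField.plaqHol Ut p) ∨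
      (GaugeField.plaqHol (spliceCfg 𝔹 X Ut) p = GaugeField.plaqHol Ut p ∧
        GaugeField.plaqHol (spliceCfg 𝔹 Xt U) p = GaugeField.plaqHol U p) := by
  by_cases hp : plaqBonds p ⊆ extBonds 𝔹
  · refine Or.inl ⟨plaqHol_congr fun b hb => ?_, plaqHol_congr fun b hb => ?_⟩
    · rw [spliceCfg_of_ext X Ut (hp hb), hU b (hp hb)]
    · rw [spliceCfg_of_ext Xt U (hp hb), hUt b (hp hb)]
  · refine Or.inr ⟨plaqHol_congr fun b hb => ?_, plaqHol_congr fun b hb => ?_⟩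
    · by_cases hbE : b ∈ extBonds 𝔹
      · rw [spliceCfg_of_ext X Ut hbE, hUt b hbE]
        exact hXt 0 b (mem_bondsOf_nearSites_of_plaq hp hb hbE)
      · rw [spliceCfg_of_not_ext X Ut hbE]
    · by_cases hbE : b ∈ extBonds 𝔹
      · rw [spliceCfg_of_ext Xt U hbE, hU b hbE]
        exact (hXt 0 b (mem_bondsOf_nearSites_of_plaq hp hb hbE)).symm
      · rw [spliceCfg_of_not_ext Xt U hbE]

/-- THE ACTION IDENTITY `A(X₀ ∣ Ũ) + A(X̃₀ ∣ U) = A(U) + A(Ũ)` for the Wilson action `A = Setup.wilsonAction4`, plaquette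
by plaquette from the pairing. [cite: Balaban1988Convergent, (2.12) p.256] -/
theorem action_splice_add (𝔹 : DetSet P) {X Xt : MSField P G} (hXt : AgreeOn (near 𝔹) X Xt) {Ut U : GaugeField P 0 G}
    (hUt : ∀ b ∈ extBonds 𝔹, Ut b = Xt 0 b) (hU : ∀ b ∈ extBonds 𝔹, U b = X 0 b) :
    wilsonAction4 (spliceCfg 𝔹 X Ut) + wilsonAction4 (spliceCfg 𝔹 Xt U) = wilsonAction4 U + wilsonAction4 Ut := by
  unfold wilsonAction4 wilsonAction
  rw [← Finset.sum_add_distrib, ← Finset.sum_add_distrib]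
  refine Finset.sum_congr rfl fun p _ => ?_
  rcases splice_splice_plaq 𝔹 hXt hUt hU p with ⟨h1, h2⟩ | ⟨h1, h2⟩
  · rw [h1, h2]
  · rw [h1, h2, add_comm]

/-- **THE SPLICE IS A MINIMAL CONFIGURATION.**  For a plaquette-determined regular class, a determining set of the
standing range, a datum `X` with a minimal configuration `W` (witnessing admissibility), a datum `X̃` agreeing with `X` on
`near 𝔹` and a minimal configuration `Ũ` for `X̃`: the splice of `Ũ` (inside) with `X₀` (on the `Γ₀`-bonds) is a minimal
configuration of (2.12) for `𝔹, X` — regular (plaquette-wise it is `W` or `Ũ`), constrained (`= X₀` on `Γ₀`; on `Γ_j`,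
`j ≥ 1`, its averages are those of `Ũ` by the locality of `M^j`, and `X̃ = X` there), and minimal: a competitor `U` for
`X` is transported to the competitor `(X̃₀ ∣ U)` for `X̃`, `A(Ũ) ≤ A(X̃₀ ∣ U)`, and the action identity gives
`A(X₀ ∣ Ũ) ≤ A(U)`.  No input from [15]. [cite: Balaban1988Convergent, (2.12) p.256] -/
theorem isMinimizer_spliceCfg {reg : Set (GaugeField P 0 G)} (hreg : PlaqDetermined reg) {av : ∀ j, Averaging P j G}
    {𝔹 : DetSet P} (h𝔹 : ∀ j, P.m + P.K < j → 𝔹 j = ∅) {X Xt : MSField P G} (hXt : AgreeOn (near 𝔹) X Xt)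
    {W Ut : GaugeField P 0 G} (hW : IsMinimizer av reg 𝔹 X W) (hUt : IsMinimizer av reg 𝔹 Xt Ut) :
    IsMinimizer av reg 𝔹 X (spliceCfg 𝔹 X Ut) := by
  obtain ⟨good, hgood⟩ := hreg
  have hWext : ∀ b ∈ extBonds 𝔹, W b = X 0 b := fun b hb => hW.2.1 0 b hb
  have hUext : ∀ b ∈ extBonds 𝔹, Ut b = Xt 0 b := fun b hb => hUt.2.1 0 b hb
  -- the splice agrees with `Ũ` on every bond feeding a higher layer
  have hfeed : ∀ {j : ℕ} {b : PBond P (j + 1)}, b ∈ bondsOf (𝔹 (j + 1)) →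
      ∀ b₀ ∈ feeds (j + 1) b, spliceCfg 𝔹 X Ut b₀ = Ut b₀ := by
    intro j b hb b₀ hb₀
    by_cases hbE : b₀ ∈ extBonds 𝔹
    · rw [spliceCfg_of_ext X Ut hbE, hUext b₀ hbE]
      exact hXt 0 b₀ (mem_bondsOf_nearSites_of_inputsPos (mem_inputsPos.2 ⟨j, b, hb, hb₀⟩) hbE)
    · rw [spliceCfg_of_not_ext X Ut hbE]
  refine ⟨?_, ?_, ?_⟩
  · -- regularity, plaquette-wise
    refine (hgood _).2 fun p => ?_
    rcases splice_splice_plaq 𝔹 hXt hUext hWext p with ⟨h1, -⟩ | ⟨h1, -⟩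
    · rw [h1]
      exact (hgood W).1 hW.1 p
    · rw [h1]
      exact (hgood Ut).1 hUt.1 p
  · -- the constraint `M_𝔹(X₀ ∣ Ũ) = X`
    intro j b hb
    cases j with
    | zero => exact spliceCfg_of_ext X Ut hb
    | succ j =>
      by_cases hj : j + 1 ≤ P.m + P.K
      · show Averaging.iter av (j + 1) (spliceCfg 𝔹 X Ut) b = X (j + 1) b
        rw [iter_local av (j + 1) hj (spliceCfg 𝔹 X Ut) Ut b (hfeed hb), hXt (j + 1) b hb]
        exact hUt.2.1 (j + 1) b hb
      · rw [h𝔹 (j + 1) (not_le.1 hj)] at hb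
        simp [bondsOf] at hb
  · -- minimality
    intro U hUreg hUc
    have hUext' : ∀ b ∈ extBonds 𝔹, U b = X 0 b := fun b hb => hUc 0 b hb
    have hcomp_reg : spliceCfg 𝔹 Xt U ∈ reg := by
      refine (hgood _).2 fun p => ?_
      rcases splice_splice_plaq 𝔹 hXt hUext hUext' p with ⟨-, h2⟩ | ⟨-, h2⟩
      · rw [h2]
        exact (hgood Ut).1 hUt.1 p
      · rw [h2]
        exact (hgood U).1 hUreg p
    have hcomp_c : AgreeOn 𝔹 (avgFamily av (spliceCfg 𝔹 Xt U)) Xt := by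
      intro j b hb
      cases j with
      | zero => exact spliceCfg_of_ext Xt U hb
      | succ j =>
        by_cases hj : j + 1 ≤ P.m + P.K
        · have hfeed' : ∀ b₀ ∈ feeds (j + 1) b, spliceCfg 𝔹 Xt U b₀ = U b₀ := by
            intro b₀ hb₀
            by_cases hbE : b₀ ∈ extBonds 𝔹
            · rw [spliceCfg_of_ext Xt U hbE, hUext' b₀ hbE]
              exact (hXt 0 b₀ (mem_bondsOf_nearSites_of_inputsPos (mem_inputsPos.2 ⟨j, b, hb, hb₀⟩) hbE)).symm
            · rw [spliceCfg_of_not_ext Xt U hbE]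
          show Averaging.iter av (j + 1) (spliceCfg 𝔹 Xt U) b = Xt (j + 1) b
          rw [iter_local av (j + 1) hj (spliceCfg 𝔹 Xt U) U b hfeed', ← hXt (j + 1) b hb]
          exact hUc (j + 1) b hb
        · rw [h𝔹 (j + 1) (not_le.1 hj)] at hb
          simp [bondsOf] at hb
    have hle : wilsonAction4 Ut ≤ wilsonAction4 (spliceCfg 𝔹 Xt U) := hUt.2.2 _ hcomp_reg hcomp_c
    have hsum := action_splice_add 𝔹 hXt hUext hUext'
    linarith

end Core

/-! ## §3  The normalised solution map `normalise bg` and its INTERIOR LOCALITY -/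

section Normalise

variable {P : Params} {G : Type*} [GaugeGroup G] {av : ∀ j, Averaging P j G}
variable (bg : DetBackground P G av)

/-- THE CANONICAL NEAR-EQUIVALENT ADMISSIBLE DATUM: Hilbert's `ε` applied to the class of data agreeing with `X` on
`near 𝔹` that are admissible for `bg` — it depends on `X` only through that class (`rep_eq_of_agreeOn`) and, for `X`
admissible, is admissible and agrees with `X` on `near 𝔹` (`rep_spec`). [cite: Balaban1988Convergent, (2.12) p.256] -/
def rep (𝔹 : DetSet P) (X : MSField P G) : MSField P G :=
  Classical.epsilon (fun Y : MSField P G => AgreeOn (near 𝔹) X Y ∧ Y ∈ bg.dom 𝔹)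

/-- For an admissible datum, `rep` is admissible and agrees with it on `near 𝔹`. [cite: Balaban1988Convergent, (2.12) p.256] -/
theorem rep_spec {𝔹 : DetSet P} {X : MSField P G} (hX : X ∈ bg.dom 𝔹) :
    AgreeOn (near 𝔹) X (rep bg 𝔹 X) ∧ rep bg 𝔹 X ∈ bg.dom 𝔹 :=
  Classical.epsilon_spec (p := fun Y : MSField P G => AgreeOn (near 𝔹) X Y ∧ Y ∈ bg.dom 𝔹) ⟨X, fun _ _ _ => rfl, hX⟩

/-- `rep` depends on the datum only through its values on `near 𝔹`. [cite: Balaban1988Convergent, (2.10) p.256] -/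
theorem rep_eq_of_agreeOn {𝔹 : DetSet P} {X X' : MSField P G} (h : AgreeOn (near 𝔹) X X') :
    rep bg 𝔹 X = rep bg 𝔹 X' := by
  unfold rep
  exact congrArg Classical.epsilon (funext fun Y => propext
    ⟨fun hY => ⟨fun j b hb => (h j b hb).symm.trans (hY.1 j b hb), hY.2⟩,
      fun hY => ⟨fun j b hb => (h j b hb).trans (hY.1 j b hb), hY.2⟩⟩)

variable (hreg : PlaqDetermined bg.reg)

open Classical in
/-- **THE NORMALISED SOLUTION MAP.**  For a solution map `bg` of the (2.12) spec with plaquette-determined regular class: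
at a determining set of the standing range, the splice of `bg`'s minimal configuration for the canonical
near-equivalent admissible datum (inside) with the datum itself (on the `Γ₀`-bonds); `bg` elsewhere.  SAME regular
class, SAME domain: it is a solution map of the same spec (`isMinimizer_spliceCfg`). [cite: Balaban1988Convergent, (2.12) p.256] -/
def normalise : DetBackground P G av where
  reg := bg.reg
  dom := bg.dom
  U 𝔹 X := if (∀ j, P.m + P.K < j → 𝔹 j = ∅) then spliceCfg 𝔹 X (bg.U 𝔹 (rep bg 𝔹 X)) else bg.U 𝔹 X
  isMinimizer 𝔹 X hX := by
    show IsMinimizer av bg.reg 𝔹 X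
      (if (∀ j, P.m + P.K < j → 𝔹 j = ∅) then spliceCfg 𝔹 X (bg.U 𝔹 (rep bg 𝔹 X)) else bg.U 𝔹 X)
    by_cases h𝔹 : ∀ j, P.m + P.K < j → 𝔹 j = ∅
    · rw [if_pos h𝔹]
      exact isMinimizer_spliceCfg hreg h𝔹 (rep_spec bg hX).1 (bg.isMinimizer 𝔹 X hX)
        (bg.isMinimizer 𝔹 _ (rep_spec bg hX).2)
    · rw [if_neg h𝔹]
      exact bg.isMinimizer 𝔹 X hX

/-- Same regular class. [cite: Balaban1988Convergent, (2.12) p.256] -/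
theorem normalise_reg : (normalise bg hreg).reg = bg.reg := rfl

/-- Same domain of admissible data. [cite: Balaban1988Convergent, (2.12) p.256] -/
theorem normalise_dom : (normalise bg hreg).dom = bg.dom := rfl

open Classical in
/-- The normalised map at a determining set of the standing range is the splice. [cite: Balaban1988Convergent, (2.12) p.256] -/
theorem normalise_U {𝔹 : DetSet P} (h𝔹 : ∀ j, P.m + P.K < j → 𝔹 j = ∅) (X : MSField P G) :
    (normalise bg hreg).U 𝔹 X = spliceCfg 𝔹 X (bg.U 𝔹 (rep bg 𝔹 X)) := by
  show (if (∀ j, P.m + P.K < j → 𝔹 j = ∅) then spliceCfg 𝔹 X (bg.U 𝔹 (rep bg 𝔹 X)) else bg.U 𝔹 X) = _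
  rw [if_pos h𝔹]

/-- On the `Γ₀`-bonds the normalised configuration IS the datum (the (2.12) constraint at scale `0`, by construction,
for every datum). [cite: Balaban1988Convergent, (2.11)–(2.12) p.256] -/
theorem normalise_U_ext {𝔹 : DetSet P} (h𝔹 : ∀ j, P.m + P.K < j → 𝔹 j = ∅) (X : MSField P G) {b : PBond P 0}
    (hb : b ∈ extBonds 𝔹) : (normalise bg hreg).U 𝔹 X b = X 0 b := by
  rw [normalise_U bg hreg h𝔹, spliceCfg_of_ext X _ hb]

/-- Inside, the normalised configuration is `bg`'s own minimal configuration for the canonical near-equivalent datum.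
[cite: Balaban1988Convergent, (2.12) p.256] -/
theorem normalise_U_int {𝔹 : DetSet P} (h𝔹 : ∀ j, P.m + P.K < j → 𝔹 j = ∅) (X : MSField P G) {b : PBond P 0}
    (hb : b ∉ extBonds 𝔹) : (normalise bg hreg).U 𝔹 X b = bg.U 𝔹 (rep bg 𝔹 X) b := by
  rw [normalise_U bg hreg h𝔹, spliceCfg_of_not_ext X _ hb]

/-- The normalised configuration is a minimal configuration of the ORIGINAL problem (2.12) for `𝔹, X`, for every
admissible datum. [cite: Balaban1988Convergent, (2.12) p.256] -/
theorem isMinimizer_normalise (𝔹 : DetSet P) {X : MSField P G} (hX : X ∈ bg.dom 𝔹) :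
    IsMinimizer av bg.reg 𝔹 X ((normalise bg hreg).U 𝔹 X) :=
  (normalise bg hreg).isMinimizer 𝔹 X hX

/-- **INTERIOR LOCALITY, PROVED** — the hypothesis `hloc` of `B14Eq216Concrete.ukBox_congr_on` / `u1loc_congr_on` for
the normalised map, with `𝔅′ := near 𝔹` and `S :=` the complement of the far bonds: data agreeing NEAR the support give
the same configuration ON the support. [cite: Balaban1988Convergent, (1.2) p.246, (2.12) p.256] -/
theorem normalise_local {𝔹 : DetSet P} (h𝔹 : ∀ j, P.m + P.K < j → 𝔹 j = ∅) {X X' : MSField P G}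
    (h : AgreeOn (near 𝔹) X X') : ∀ b, b ∉ farBonds 𝔹 → (normalise bg hreg).U 𝔹 X b = (normalise bg hreg).U 𝔹 X' b := by
  intro b hb
  rw [normalise_U bg hreg h𝔹, normalise_U bg hreg h𝔹, rep_eq_of_agreeOn bg h]
  by_cases hbE : b ∈ extBonds 𝔹
  · rw [spliceCfg_of_ext X _ hbE, spliceCfg_of_ext X' _ hbE]
    exact h 0 b (near_of_ext_not_far hbE hb)
  · rw [spliceCfg_of_not_ext X _ hbE, spliceCfg_of_not_ext X' _ hbE]

/-- In particular the (2.10)-locality shape of `B14Eq216Concrete.ukBox_congr` (r13's `exists_local` clause (i)) holds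
for the normalised map off the far bonds. [cite: Balaban1988Convergent, (2.10) p.256, (2.12) p.256] -/
theorem normalise_local_of_agreeOn {𝔹 : DetSet P} (h𝔹 : ∀ j, P.m + P.K < j → 𝔹 j = ∅) {X X' : MSField P G}
    (h : AgreeOn 𝔹 X X') : ∀ b, b ∉ farBonds 𝔹 → (normalise bg hreg).U 𝔹 X b = (normalise bg hreg).U 𝔹 X' b :=
  normalise_local bg hreg h𝔹 (agreeOn_near_of_agreeOn h)

/-- The packaged form, in the shape of r13's `B16Eq150VariableFields.exists_local`: **interior locality is a
normalisation** — for every solution map with plaquette-determined regular class there is one of the same spec, the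
same class and the same domain that is interior-local at every determining set of the standing range, equals the
datum on the `Γ₀`-bonds, and inside equals the original map's minimal configuration for an admissible datum agreeing
with the given one near the support. [cite: Balaban1988Convergent, (1.2) p.246, (2.12) p.256] -/
theorem exists_interiorLocal (bg : DetBackground P G av) (hreg : PlaqDetermined bg.reg) :
    ∃ bg' : DetBackground P G av, bg'.reg = bg.reg ∧ bg'.dom = bg.dom ∧
      ∀ 𝔹 : DetSet P, (∀ j, P.m + P.K < j → 𝔹 j = ∅) →
        (∀ X X' : MSField P G, AgreeOn (near 𝔹) X X' → ∀ b, b ∉ farBonds 𝔹 → bg'.U 𝔹 X b = bg'.U 𝔹 X' b) ∧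
        (∀ X : MSField P G, ∀ b ∈ extBonds 𝔹, bg'.U 𝔹 X b = X 0 b) ∧
        ∀ X ∈ bg.dom 𝔹, ∃ Y ∈ bg.dom 𝔹, AgreeOn (near 𝔹) X Y ∧ ∀ b, b ∉ extBonds 𝔹 → bg'.U 𝔹 X b = bg.U 𝔹 Y b :=
  ⟨normalise bg hreg, rfl, rfl, fun 𝔹 h𝔹 =>
    ⟨fun _ _ h => normalise_local bg hreg h𝔹 h, fun X _ hb => normalise_U_ext bg hreg h𝔹 X hb, fun X hX =>
      ⟨rep bg 𝔹 X, (rep_spec bg hX).2, (rep_spec bg hX).1, fun _ hb => normalise_U_int bg hreg h𝔹 X hb⟩⟩⟩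

end Normalise

/-! ## §4  The p. 246 sentence WITHOUT `hloc`: (2.16) and (1.2) on the normalised solution map -/

section Consequences

variable {P : Params} {G : Type*} [GaugeGroup G] {av : ∀ j, Averaging P j G}
variable (bg : DetBackground P G av) (hreg : PlaqDetermined bg.reg) (M₁ : ℕ)

/-- `𝐁_k(□^{∼4})` lives in the standing range for `k ≤ m + K`. [cite: Balaban1988Convergent, (2.13) p.256] -/
theorem Bj_standingRange (box4 : Set (Site P 0)) {k : ℕ} (hk : k ≤ P.m + P.K) : ∀ j, P.m + P.K < j → Bj M₁ box4 k j = ∅ :=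
  fun _ hj => Bj_of_gt (lt_of_le_of_lt hk hj)

/-- **(2.16), dependence on `V_k` at support level, NO locality hypothesis**: for the normalised solution map,
`U_{k,□}(V_k) = U_{k,□}(W_k)` on every bond except the far `Γ₀`-bonds of `𝐁_k(□^{∼4})` as soon as `V_k = W_k` on
`liftIter k (inputs (near 𝐁_k(□^{∼4})))` (`k ≤ m + K`) — `B14Eq216Concrete.ukBox_congr_on` with its `hloc` supplied by
`normalise_local`. [cite: Balaban1988Convergent, (2.16) p.257] -/
theorem ukBox_normalise_congr_on {box4 : Set (Site P 0)} {k : ℕ} (hk : k ≤ P.m + P.K) {Vk Wk : GaugeField P k G}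
    (h : ∀ c ∈ liftIter k (inputs (near (Bj M₁ box4 k))), Vk c = Wk c) :
    ∀ b₀ ∈ (farBonds (Bj M₁ box4 k))ᶜ,
      ukBox (normalise bg hreg) M₁ box4 k Vk b₀ = ukBox (normalise bg hreg) M₁ box4 k Wk b₀ :=
  ukBox_congr_on (normalise bg hreg) M₁ (near (Bj M₁ box4 k)) (near_range (Bj_standingRange M₁ box4 hk))
    (farBonds (Bj M₁ box4 k))ᶜ (fun _ _ hX b₀ hb₀ => normalise_local bg hreg (Bj_standingRange M₁ box4 hk) hX b₀ hb₀) h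

/-- Monotonicity of `lift1`. [cite: Balaban1988Convergent, (1.3) p.246] -/
theorem lift1_subset_lift1 {j : ℕ} {S T : Set (PBond P j)} (h : S ⊆ T) : lift1 S ⊆ lift1 T := by
  intro c hc
  obtain ⟨b, hb, hne, hcb⟩ := mem_lift1.1 hc
  exact mem_lift1.2 ⟨b, h hb, hne, hcb⟩

/-- Monotonicity of `liftIter`. [cite: Balaban1988Convergent, (1.3) p.246] -/
theorem liftIter_subset_liftIter : ∀ (k : ℕ) {S T : Set (PBond P 0)}, S ⊆ T → liftIter k S ⊆ liftIter k T
  | 0, _, _, h => h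
  | k + 1, _, _, h => by
    rw [liftIter_succ, liftIter_succ]
    exact lift1_subset_lift1 (liftIter_subset_liftIter k h)

/-- The agreement set of `ukBox_normalise_congr_on` is contained in the whole-torus agreement set of
`B14Eq216Concrete.ukBox_congr` (it omits the far exterior). [cite: Balaban1988Convergent, (2.16) p.257] -/
theorem liftIter_inputs_near_subset (box4 : Set (Site P 0)) (k : ℕ) :
    liftIter k (inputs (near (Bj M₁ box4 k))) ⊆ liftIter k (inputs (Bj M₁ box4 k)) :=
  liftIter_subset_liftIter k (inputs_near_subset _)

end Consequences

section SectOne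

variable {P : Params} {G : Type} [GaugeGroup G] {av : ∀ j, Averaging P j G}
variable (bg : DetBackground P G av) (hreg : PlaqDetermined bg.reg) (M₁ : ℕ)

open B14.Sect1Repr

/-- **The p. 246 sentence, unconditionally**: *"The function in (1.2) depends on the field V restricted to □′^{∼4}"* —
for (1.2) built on the normalised solution map (`B14Eq216Concrete.sect1Of (normalise bg)`), `U_{1,□′}(V) = U_{1,□′}(W)`
on every bond except the far `Γ₀`-bonds of `𝐁₁(□′^{∼4})` whenever `V = W` on the `T^{(1)}`-bonds
`lift1 (inputs (near 𝐁₁(□′^{∼4})))` — the bonds feeding the data of `𝐁₁(□′^{∼4})` on `Ω₁(□′^{∼4})` and on its near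
`Γ₀`-layer (over `□′^{∼4}` in print's geometry p. 256; `1 ≤ m + K`).  `B14Eq216Concrete.u1loc_congr_on` with its `hloc`
supplied by `normalise_local`; nothing of [15] is used. [cite: Balaban1988Convergent, (1.2) p.246] -/
theorem u1loc_normalise_congr_on (D : Sect1Data P G) (enl4 : D.Cube1 → Set (Site P 0)) (c : D.Cube1)
    (h1 : 1 ≤ P.m + P.K) {V W : GaugeField P 1 G}
    (h : ∀ c' ∈ lift1 (inputs (near (Bj M₁ (enl4 c) 1))), V c' = W c') :
    ∀ b₀ ∈ (farBonds (Bj M₁ (enl4 c) 1))ᶜ,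
      U1loc (sect1Of (normalise bg hreg) M₁ D enl4) c V b₀ = U1loc (sect1Of (normalise bg hreg) M₁ D enl4) c W b₀ :=
  u1loc_congr_on (normalise bg hreg) M₁ D enl4 c (near (Bj M₁ (enl4 c) 1)) (near_range (Bj_standingRange M₁ (enl4 c) h1))
    (farBonds (Bj M₁ (enl4 c) 1))ᶜ (fun _ _ hX b₀ hb₀ => normalise_local bg hreg (Bj_standingRange M₁ (enl4 c) h1) hX b₀ hb₀) h

/-- … and on the far `Γ₀`-bonds `U_{1,□′}(V)` is the datum `Q₁^{s*}V` itself (the (2.12) constraint at scale `0`), for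
every `V`. [cite: Balaban1988Convergent, (1.2) p.246, (2.11) p.256] -/
theorem u1loc_normalise_ext (D : Sect1Data P G) (enl4 : D.Cube1 → Set (Site P 0)) (c : D.Cube1) (h1 : 1 ≤ P.m + P.K)
    (V : GaugeField P 1 G) {b₀ : PBond P 0} (hb₀ : b₀ ∈ extBonds (Bj M₁ (enl4 c) 1)) :
    U1loc (sect1Of (normalise bg hreg) M₁ D enl4) c V b₀ = qsstarGIter0 1 V b₀ := by
  rw [u1loc_sect1Of, ukBox_apply, normalise_U_ext bg hreg (Bj_standingRange M₁ (enl4 c) h1) _ hb₀]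
  rfl

end SectOne

end Literature.MathematicalPhysics.QuantumFieldTheory.Balaban1983to89.B14.Eq12InteriorLocality

end
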